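import Summits.ValiantsHypothesis.ValiantsHypothesis.Theorems.LacunarySymmetroidMatrixDescartesCensusFlankRow
import Summits.ValiantsHypothesis.ValiantsHypothesis.Theorems.LacunarySymmetroidMatrixDescartesCensusFullAlternationMult
import Summits.ValiantsHypothesis.ValiantsHypothesis.Theorems.LacunarySymmetroidMatrixDescartesCensusCircuitRow

/-!
# `MatrixDescartes` census — W4 boundary layer: the ROWS OF A SHARP FEWNOMIAL (signs, non-vanishing, and the
circuit row of every triple) — the generic leaf lemmas of the face-row LP certificates

HONEST FRAMING.  Object-search cell `pub-symmetroid`, item `DoorA26 = PosRootLawAt 2 6 19` (stmt-ValiantsHypothesis-19979,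
OPEN, typed, never asserted).  The boundary-layer certificates of the W4 line (THEOREM GB `…CensusGramBlockBoundary`, the
corrected signed face-row LP FACELP27-E2G27 / engine-1 v7, the hybrid ratio branch-and-bound HYBRID27-E2G27) are all built
from ONE kind of row: kill all but three positions `r < s < u` of a hypothetical Descartes-sharp hull-edge form
`f = Σ_{t<n} c_t X^{e_t}` (`n − 1` positive roots with multiplicity) by Euler twists (`countP_posRoots_le_countP_twists`,
≤ 1 root lost per twist); the residual trinomial keeps two positive roots, so it alternates and satisfies the CIRCUIT ROW
(`circuit_row_abs_of_posRoot`, engine-1 g24 p512725).  This file packages that once and for all, for ANY fewnomial given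
as a `range`-indexed sum with strictly increasing exponents:

* `support_rsum_of_sharp`, `coeff_ne_zero_of_sharp`, `sign_of_sharp` — a sharp fewnomial has every coefficient non-zero
  and `(−1)^{s+t} c_s c_t > 0` (full alternation, via `pow_rank_mul_coeff_mul_coeff_pos_of_sharp_countP`);
* `circuit_row_of_sharp` — for every triple `r < s < u`, with `p = e_s − e_r`, `q = e_u − e_s` and the INTEGER twist
  multipliers `M_t = |∏_{v ∉ {r,s,u}} (e_t − e_v)|` supplied as hypotheses a numeric instance discharges by `norm_num`:
  `(p+q)^{p+q} (|c_r| M_r)^q (|c_u| M_u)^p ≤ (|c_s| M_s)^{p+q} q^q p^p`.  Sibling of engine-1 g24's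
  `circuit_triple_row` (`…CensusCircuitTripleRow`, one residual root + `A·D > 0` as a HYPOTHESIS); here FULL sharpness
  is assumed and `A·D > 0` is DERIVED from the residual trinomial's own alternation, so that per-support kill files can
  be stated sign-free and generated without per-row sign side-goals — the AM–GM step is `circuit_row_abs_of_posRoot`
  in both, not redone;
* `circuit_row_log_of_sharp` — the same row in the LOG-LINEAR form the LP uses:
  `log L + q·log|c_r| + p·log|c_u| ≤ (p+q)·log|c_s| + log R`, `L = (p+q)^{p+q} M_r^q M_u^p`, `R = q^q p^p M_s^{p+q}`;
* three one-line real-number helpers for the «alone / collision» rows (`abs_add_eq_abs_add_abs_of_mul_pos`,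
  `abs_add_le_abs_of_mul_neg`, `log_abs_mul`).

A per-support kill file then reads: rows (instances of the above) → `linarith` on the Farkas combination → one `norm_num`
comparison of two natural numbers.  Tools only; nothing here kills a cell, bounds `ζ_sym(2,6)`, decides `DoorA26`, or bears
on `MatrixDescartes` (stmt-ValiantsHypothesis-18050) / `VP ≠ VNP`.

[folklore] Descartes' rule with multiplicity, Rolle with multiplicity (Euler twists), weighted AM–GM; no single source.
-/

-- `Summit.ValiantsHypothesis.ValiantsHypothesis.…` repeats a component by the D-0017 layout
-- (single-conjunct summit), which the `dupNamespace` linter flags; the name is mandated.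
set_option linter.dupNamespace false

namespace Summit.ValiantsHypothesis.ValiantsHypothesis.Theorems.LacunarySymmetroidMatrixDescartes.Census

open Polynomial Finset
open scoped BigOperators Polynomial

/-! ### Support and coefficients of a `range`-indexed fewnomial -/

/-- The support of `Σ_{t<n} c_t X^{e_t}` lies in the exponent set `e(range n)`. [folklore] -/
theorem support_rsum_subset (n : ℕ) (e : ℕ → ℕ) (c : ℕ → ℝ) :
    (∑ t ∈ range n, C (c t) * X ^ (e t) : ℝ[X]).support ⊆ (range n).image e := by
  intro j hj
  rw [mem_support_iff, coeff_rsum] at hj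
  by_contra hne
  apply hj
  refine Finset.sum_eq_zero fun t ht => ?_
  rw [if_neg]
  rintro rfl
  exact hne (mem_image_of_mem e ht)

/-- Strictly increasing exponents on `range n` are injective there. [folklore] -/
theorem rsum_injOn_of_lt {n : ℕ} {e : ℕ → ℕ} (he : ∀ i j, i < j → j < n → e i < e j) :
    ∀ i, i < n → ∀ j, j < n → e i = e j → i = j := by
  intro i hi j hj hij
  rcases lt_trichotomy i j with h | h | h
  · exact absurd hij (he i j h hj).ne
  · exact h
  · exact absurd hij.symm (he j i h hi).ne

/-- The coefficient of `Σ_{t<n} c_t X^{e_t}` at `e_s` is `c_s` (exponents injective on `range n`). [folklore] -/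
theorem coeff_rsum_of_injOn (n : ℕ) (e : ℕ → ℕ) (c : ℕ → ℝ)
    (he : ∀ i, i < n → ∀ j, j < n → e i = e j → i = j) {s : ℕ} (hs : s < n) :
    (∑ t ∈ range n, C (c t) * X ^ (e t) : ℝ[X]).coeff (e s) = c s := by
  rw [coeff_rsum, Finset.sum_eq_single s]
  · rw [if_pos rfl]
  · intro t ht hts
    rw [if_neg]
    exact fun h => hts (he t (mem_range.mp ht) s hs h.symm)
  · intro h
    exact absurd (mem_range.mpr hs) h

/-- Rank of `e_s` in the exponent set: exactly `s` exponents lie below it. [folklore] -/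
theorem card_filter_lt_rsum {n : ℕ} {e : ℕ → ℕ} (he : ∀ i j, i < j → j < n → e i < e j) {s : ℕ} (hs : s < n) :
    (((range n).image e).filter (fun j => j < e s)).card = s := by
  have hset : ((range n).image e).filter (fun j => j < e s) = (range s).image e := by
    ext j
    simp only [mem_filter, mem_image, mem_range]
    constructor
    · rintro ⟨⟨t, ht, rfl⟩, hlt⟩
      refine ⟨t, ?_, rfl⟩
      by_contra h
      rw [not_lt] at h
      rcases h.eq_or_lt with h' | h'
      · rw [h'] at hlt
        exact lt_irrefl _ hlt
      · exact absurd hlt (not_lt.mpr (he s t h' ht).le)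
    · rintro ⟨t, ht, rfl⟩
      exact ⟨⟨t, by omega, rfl⟩, he t s ht hs⟩
  rw [hset, card_image_of_injOn]
  · exact card_range s
  · intro i hi j hj hij
    simp only [coe_range, Set.mem_Iio] at hi hj
    exact rsum_injOn_of_lt he i (by omega) j (by omega) hij

/-! ### A Descartes-sharp fewnomial: support, non-vanishing, full alternation -/

/-- **Support of a sharp fewnomial.**  If `Σ_{t<n} c_t X^{e_t}` (`n ≥ 2`, exponents strictly increasing on
`range n`) has at least `n − 1` positive roots counted with multiplicity, its support is the whole exponent set
(Descartes: `n − 1 ≤ #Z₊ ≤ Var < #supp ≤ n`). [folklore] -/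
theorem support_rsum_of_sharp {n : ℕ} {e : ℕ → ℕ} {c : ℕ → ℝ} (hn : 2 ≤ n)
    (hZ : n ≤ (∑ t ∈ range n, C (c t) * X ^ (e t) : ℝ[X]).roots.countP (fun x => 0 < x) + 1) :
    (∑ t ∈ range n, C (c t) * X ^ (e t) : ℝ[X]).support = (range n).image e := by
  set f : ℝ[X] := ∑ t ∈ range n, C (c t) * X ^ (e t) with hf_def
  have hf : f ≠ 0 := by
    intro h0
    rw [h0, roots_zero] at hZ
    simp at hZ
    omega
  refine Finset.eq_of_subset_of_card_le (support_rsum_subset n e c) ?_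
  have h1 := f.roots_countP_pos_le_signVariations
  have h2 := Literature.Computability.AlgebraicComplexity.signVariations_lt_card_support hf
  calc ((range n).image e).card ≤ (range n).card := card_image_le
    _ = n := card_range n
    _ ≤ f.support.card := by omega

/-- **No coefficient of a sharp fewnomial vanishes.** [folklore] -/
theorem coeff_ne_zero_of_sharp {n : ℕ} {e : ℕ → ℕ} {c : ℕ → ℝ} (he : ∀ i j, i < j → j < n → e i < e j)
    (hn : 2 ≤ n)
    (hZ : n ≤ (∑ t ∈ range n, C (c t) * X ^ (e t) : ℝ[X]).roots.countP (fun x => 0 < x) + 1)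
    {s : ℕ} (hs : s < n) : c s ≠ 0 := by
  have hmem : e s ∈ (∑ t ∈ range n, C (c t) * X ^ (e t) : ℝ[X]).support := by
    rw [support_rsum_of_sharp hn hZ]
    exact mem_image_of_mem _ (mem_range.mpr hs)
  rw [mem_support_iff, coeff_rsum_of_injOn n e c (rsum_injOn_of_lt he) hs] at hmem
  exact hmem

/-- **Full alternation of a sharp fewnomial (F1 with multiplicity, rank form).**  If `Σ_{t<n} c_t X^{e_t}`
(`n ≥ 2`, exponents strictly increasing on `range n`) has at least `n − 1` positive roots counted with multiplicity,
then `(−1)^{s+t} c_s c_t > 0` for all `s, t < n`. [folklore] -/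
theorem sign_of_sharp {n : ℕ} {e : ℕ → ℕ} {c : ℕ → ℝ} (he : ∀ i j, i < j → j < n → e i < e j) (hn : 2 ≤ n)
    (hZ : n ≤ (∑ t ∈ range n, C (c t) * X ^ (e t) : ℝ[X]).roots.countP (fun x => 0 < x) + 1)
    {s t : ℕ} (hs : s < n) (ht : t < n) : 0 < (-1 : ℝ) ^ (s + t) * (c s * c t) := by
  set f : ℝ[X] := ∑ t ∈ range n, C (c t) * X ^ (e t) with hf_def
  have hsupp : f.support = (range n).image e := support_rsum_of_sharp hn hZ
  have hcard : f.support.card ≤ f.roots.countP (fun x => 0 < x) + 1 := by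
    rw [hsupp]
    calc ((range n).image e).card ≤ (range n).card := card_image_le
      _ = n := card_range n
      _ ≤ _ := hZ
  have hinj := rsum_injOn_of_lt he
  have hms : e s ∈ f.support := by rw [hsupp]; exact mem_image_of_mem _ (mem_range.mpr hs)
  have hmt : e t ∈ f.support := by rw [hsupp]; exact mem_image_of_mem _ (mem_range.mpr ht)
  have key := pow_rank_mul_coeff_mul_coeff_pos_of_sharp_countP f hcard hms hmt
  rw [hsupp, card_filter_lt_rsum he hs, card_filter_lt_rsum he ht, hf_def,
    coeff_rsum_of_injOn n e c hinj hs, coeff_rsum_of_injOn n e c hinj ht] at key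
  exact key

/-! ### The circuit row of every triple of a sharp fewnomial -/

/-- **CIRCUIT ROW OF A SHARP FEWNOMIAL.**  Let `Σ_{t<n} c_t X^{e_t}` (exponents strictly increasing on `range n`)
have at least `n − 1` positive roots counted with multiplicity, and let `r < s < u < n`, `p = e_s − e_r`,
`q = e_u − e_s`.  Killing the other `n − 3` exponents by Euler twists (`countP_posRoots_le_countP_twists`) leaves
`c_r P_r X^{e_r} + c_s P_s X^{e_s} + c_u P_u X^{e_u}`, `P_t = ∏_{v<n, v∉{r,s,u}} (e_t − e_v)`, with two positive roots;
it alternates (`sign_of_sharp` for three terms), so the circuit row (`circuit_row_abs_of_posRoot`) gives, with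
`M_t = |P_t|` supplied as hypotheses: `(p+q)^{p+q} (|c_r| M_r)^q (|c_u| M_u)^p ≤ (|c_s| M_s)^{p+q} q^q p^p`.
[folklore; the circuit number: cite IlimanDewolff2016 Thm 3.8 via `…CensusCircuitRow`] -/
theorem circuit_row_of_sharp {n : ℕ} {e : ℕ → ℕ} {c : ℕ → ℝ} (he : ∀ i j, i < j → j < n → e i < e j)
    (hZ : n ≤ (∑ t ∈ range n, C (c t) * X ^ (e t) : ℝ[X]).roots.countP (fun x => 0 < x) + 1)
    {r s u : ℕ} (hrs : r < s) (hsu : s < u) (hun : u < n) (p q : ℕ) (hp : e r + p = e s) (hq : e s + q = e u)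
    (Mr Ms Mu : ℝ)
    (hMr : |∏ v ∈ (range n).filter (fun v => ¬(v = r ∨ v = s ∨ v = u)), ((e r : ℝ) - e v)| = Mr)
    (hMs : |∏ v ∈ (range n).filter (fun v => ¬(v = r ∨ v = s ∨ v = u)), ((e s : ℝ) - e v)| = Ms)
    (hMu : |∏ v ∈ (range n).filter (fun v => ¬(v = r ∨ v = s ∨ v = u)), ((e u : ℝ) - e v)| = Mu) :
    ((p + q : ℕ) : ℝ) ^ (p + q) * ((|c r| * Mr) ^ q * (|c u| * Mu) ^ p)
      ≤ (|c s| * Ms) ^ (p + q) * ((q : ℝ) ^ q * (p : ℝ) ^ p) := by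
  classical
  have hn : 2 ≤ n := by omega
  have hp0 : 0 < p := by have := he r s hrs (by omega); omega
  have hq0 : 0 < q := by have := he s u hsu hun; omega
  set U : Finset ℕ := (range n).filter (fun v => ¬(v = r ∨ v = s ∨ v = u)) with hU_def
  -- the kept set
  have hK : (range n).filter (fun v => v = r ∨ v = s ∨ v = u) = insert r (insert s {u}) := by
    ext v
    simp only [mem_filter, mem_range, mem_insert, mem_singleton]
    constructor
    · rintro ⟨-, h⟩; exact h
    · intro h; refine ⟨?_, h⟩; rcases h with h | h | h <;> omega
  have hUcard : U.card = n - 3 := by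
    have h := Finset.card_filter_add_card_filter_not (s := range n) (fun v => v = r ∨ v = s ∨ v = u)
    rw [hK, card_range] at h
    have h3 : (insert r (insert s ({u} : Finset ℕ))).card = 3 := by
      rw [card_insert_of_notMem, card_insert_of_notMem, card_singleton]
      · simp only [mem_singleton]; omega
      · simp only [mem_insert, mem_singleton]; omega
    rw [h3] at h
    rw [hU_def]
    omega
  -- Euler twists
  have step := countP_posRoots_le_countP_twists n e c U
  rw [hUcard] at step
  set P : ℕ → ℝ := fun t => ∏ v ∈ U, ((e t : ℝ) - e v) with hP_def
  have hres : (∑ t ∈ range n, C (c t * ∏ v ∈ U, ((e t : ℝ) - e v)) * X ^ (e t) : ℝ[X])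
      = C (c r * P r) * X ^ (e r) + C (c s * P s) * X ^ (e s) + C (c u * P u) * X ^ (e u) := by
    rw [← Finset.sum_filter_add_sum_filter_not (range n) (fun v => v = r ∨ v = s ∨ v = u), hK]
    have hz : (∑ t ∈ U, C (c t * ∏ v ∈ U, ((e t : ℝ) - e v)) * X ^ (e t) : ℝ[X]) = 0 := by
      refine Finset.sum_eq_zero fun t ht => ?_
      rw [Finset.prod_eq_zero ht (sub_self _), mul_zero, map_zero, zero_mul]
    rw [← hU_def, hz, add_zero, sum_insert, sum_insert, sum_singleton]
    · simp only [hP_def]; ring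
    · simp only [mem_singleton]; omega
    · simp only [mem_insert, mem_singleton]; omega
  rw [hres] at step
  have hroot2 : 2 ≤ ((C (c r * P r) * X ^ (e r) + C (c s * P s) * X ^ (e s) + C (c u * P u) * X ^ (e u) :
      ℝ[X]).roots.countP (fun x => 0 < x)) := by omega
  -- the residual trinomial is itself sharp: alternation gives `A·D > 0`
  set e' : ℕ → ℕ := fun t => if t = 0 then e r else if t = 1 then e s else e u with he'_def
  set c' : ℕ → ℝ := fun t => if t = 0 then c r * P r else if t = 1 then c s * P s else c u * P u with hc'_def
  have hres3 : (∑ t ∈ range 3, C (c' t) * X ^ (e' t) : ℝ[X])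
      = C (c r * P r) * X ^ (e r) + C (c s * P s) * X ^ (e s) + C (c u * P u) * X ^ (e u) := by
    simp only [Finset.sum_range_succ, Finset.sum_range_zero, zero_add, he'_def, hc'_def]
    norm_num
  have hers : e r < e s := he r s hrs (by omega)
  have hesu : e s < e u := he s u hsu hun
  have he' : ∀ i j, i < j → j < 3 → e' i < e' j := by
    intro i j hij hj
    interval_cases j <;> interval_cases i <;> simp [he'_def] <;> omega
  have hZ3 : 3 ≤ (∑ t ∈ range 3, C (c' t) * X ^ (e' t) : ℝ[X]).roots.countP (fun x => 0 < x) + 1 := by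
    rw [hres3]; omega
  have hAD : 0 < (c r * P r) * (c u * P u) := by
    have h := sign_of_sharp he' (by norm_num) hZ3 (show 0 < 3 by norm_num) (show 2 < 3 by norm_num)
    simp only [hc'_def] at h
    norm_num at h
    exact h
  -- the circuit row of the residual trinomial
  have hroot : 0 < ((C (c r * P r) * X ^ (e r) + C (c s * P s) * X ^ (e r + p)
      + C (c u * P u) * X ^ (e r + p + q) : ℝ[X]).roots.countP (fun x => 0 < x)) := by
    rw [show e r + p = e s from hp, show e s + q = e u from hq]; omega
  have row := circuit_row_abs_of_posRoot (c r * P r) (c s * P s) (c u * P u) (e r) p q hAD hp0 hq0 hroot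
  rw [abs_mul, abs_mul, abs_mul, hMr, hMs, hMu] at row
  exact row

/-- Non-vanishing of a twist multiplier: `∏_{v<n, v∉{r,s,u}} (e_t − e_v) ≠ 0` for `t ∈ {r,s,u}` (exponents
injective on `range n`). [folklore] -/
theorem prod_sub_ne_zero_of_lt {n : ℕ} {e : ℕ → ℕ} (he : ∀ i j, i < j → j < n → e i < e j)
    {r s u t : ℕ} (ht : t = r ∨ t = s ∨ t = u) (htn : t < n) :
    (∏ v ∈ (range n).filter (fun v => ¬(v = r ∨ v = s ∨ v = u)), ((e t : ℝ) - e v)) ≠ 0 := by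
  rw [Finset.prod_ne_zero_iff]
  intro v hv
  simp only [mem_filter, mem_range] at hv
  have hvt : v ≠ t := by rintro rfl; exact hv.2 ht
  have hne : e t ≠ e v := fun h => hvt (rsum_injOn_of_lt he t htn v hv.1 h).symm
  rw [sub_ne_zero]
  exact_mod_cast hne

/-- **CIRCUIT ROW, LOG-LINEAR FORM** (the face-row LP's «triple row»).  Under the hypotheses of
`circuit_row_of_sharp`, with the numerals `L = (p+q)^{p+q} M_r^q M_u^p` and `R = q^q p^p M_s^{p+q}`:
`log L + q·log|c_r| + p·log|c_u| ≤ (p+q)·log|c_s| + log R`. [folklore] -/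
theorem circuit_row_log_of_sharp {n : ℕ} {e : ℕ → ℕ} {c : ℕ → ℝ} (he : ∀ i j, i < j → j < n → e i < e j)
    (hZ : n ≤ (∑ t ∈ range n, C (c t) * X ^ (e t) : ℝ[X]).roots.countP (fun x => 0 < x) + 1)
    {r s u : ℕ} (hrs : r < s) (hsu : s < u) (hun : u < n) (p q : ℕ) (hp : e r + p = e s) (hq : e s + q = e u)
    (Mr Ms Mu L R : ℝ)
    (hMr : |∏ v ∈ (range n).filter (fun v => ¬(v = r ∨ v = s ∨ v = u)), ((e r : ℝ) - e v)| = Mr)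
    (hMs : |∏ v ∈ (range n).filter (fun v => ¬(v = r ∨ v = s ∨ v = u)), ((e s : ℝ) - e v)| = Ms)
    (hMu : |∏ v ∈ (range n).filter (fun v => ¬(v = r ∨ v = s ∨ v = u)), ((e u : ℝ) - e v)| = Mu)
    (hL : ((p + q : ℕ) : ℝ) ^ (p + q) * (Mr ^ q * Mu ^ p) = L)
    (hR : (q : ℝ) ^ q * (p : ℝ) ^ p * Ms ^ (p + q) = R) :
    Real.log L + q * Real.log |c r| + p * Real.log |c u| ≤ (p + q) * Real.log |c s| + Real.log R := by
  have hn : 2 ≤ n := by omega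
  have hp0 : 0 < p := by have := he r s hrs (by omega); omega
  have hq0 : 0 < q := by have := he s u hsu hun; omega
  have row := circuit_row_of_sharp he hZ hrs hsu hun p q hp hq Mr Ms Mu hMr hMs hMu
  have hMr0 : 0 < Mr := by
    rw [← hMr, abs_pos]; exact prod_sub_ne_zero_of_lt he (Or.inl rfl) (by omega)
  have hMs0 : 0 < Ms := by
    rw [← hMs, abs_pos]; exact prod_sub_ne_zero_of_lt he (Or.inr (Or.inl rfl)) (by omega)
  have hMu0 : 0 < Mu := by
    rw [← hMu, abs_pos]; exact prod_sub_ne_zero_of_lt he (Or.inr (Or.inr rfl)) hun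
  have hcr : 0 < |c r| := abs_pos.mpr (coeff_ne_zero_of_sharp he hn hZ (by omega))
  have hcs : 0 < |c s| := abs_pos.mpr (coeff_ne_zero_of_sharp he hn hZ (by omega))
  have hcu : 0 < |c u| := abs_pos.mpr (coeff_ne_zero_of_sharp he hn hZ hun)
  have hL0 : 0 < L := by rw [← hL]; positivity
  have hR0 : 0 < R := by rw [← hR]; positivity
  have row' : L * (|c r| ^ q * |c u| ^ p) ≤ |c s| ^ (p + q) * R := by
    have h1 : L * (|c r| ^ q * |c u| ^ p) = ((p + q : ℕ) : ℝ) ^ (p + q) * ((|c r| * Mr) ^ q * (|c u| * Mu) ^ p) := by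
      rw [← hL]; ring
    have h2 : |c s| ^ (p + q) * R = (|c s| * Ms) ^ (p + q) * ((q : ℝ) ^ q * (p : ℝ) ^ p) := by
      rw [← hR]; ring
    rw [h1, h2]; exact row
  have hlog := Real.log_le_log (by positivity) row'
  rw [Real.log_mul hL0.ne' (by positivity), Real.log_mul (by positivity) (by positivity),
    Real.log_pow, Real.log_pow, Real.log_mul (by positivity) hR0.ne', Real.log_pow] at hlog
  push_cast at hlog ⊢
  linarith

/-! ### One-line helpers for the alone / collision rows -/

/-- Same-sign parts add in absolute value: `x·y > 0 ⇒ |x + y| = |x| + |y|`. [folklore] -/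
theorem abs_add_eq_abs_add_abs_of_mul_pos {x y : ℝ} (h : 0 < x * y) : |x + y| = |x| + |y| := by
  rcases lt_or_gt_of_ne (show x ≠ 0 by rintro rfl; simp at h) with hx | hx
  · have hy : y < 0 := by nlinarith
    rw [abs_of_neg hx, abs_of_neg hy, abs_of_neg (by linarith)]; ring
  · have hy : 0 < y := by nlinarith
    rw [abs_of_pos hx, abs_of_pos hy, abs_of_pos (by linarith)]

/-- Opposite-sign parts with the first dominant: `x·y < 0` and `x·(x+y) > 0 ⇒ |x + y| ≤ |x|`. [folklore] -/
theorem abs_add_le_abs_of_mul_neg {x y : ℝ} (h : x * y < 0) (hd : 0 < x * (x + y)) : |x + y| ≤ |x| := by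
  rcases lt_or_gt_of_ne (show x ≠ 0 by rintro rfl; simp at h) with hx | hx
  · have hy : 0 < y := by nlinarith
    have hxy : x + y < 0 := by nlinarith
    rw [abs_of_neg hx, abs_of_neg hxy]; linarith
  · have hy : y < 0 := by nlinarith
    have hxy : 0 < x + y := by nlinarith
    rw [abs_of_pos hx, abs_of_pos hxy]; linarith

/-- `log|x·y| = log|x| + log|y|` for `x, y ≠ 0`. [folklore] -/
theorem log_abs_mul {x y : ℝ} (hx : x ≠ 0) (hy : y ≠ 0) :
    Real.log |x * y| = Real.log |x| + Real.log |y| := by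
  rw [abs_mul, Real.log_mul (abs_ne_zero.mpr hx) (abs_ne_zero.mpr hy)]

/-- Opposite-sign parts with the first dominant: `x·y < 0` and `x·(x+y) > 0 ⇒ |y| ≤ |x|`. [folklore] -/
theorem abs_le_abs_of_mul_neg {x y : ℝ} (h : x * y < 0) (hd : 0 < x * (x + y)) : |y| ≤ |x| := by
  rcases lt_or_gt_of_ne (show x ≠ 0 by rintro rfl; simp at h) with hx | hx
  · have hy : 0 < y := by nlinarith
    have hxy : x + y < 0 := by nlinarith
    rw [abs_of_neg hx, abs_of_pos hy]; linarith
  · have hy : y < 0 := by nlinarith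
    have hxy : 0 < x + y := by nlinarith
    rw [abs_of_pos hx, abs_of_neg hy]; linarith

/-- Opposite-sign parts with the first dominant: `|x + y| = |x| − |y|`. [folklore] -/
theorem abs_add_eq_abs_sub_abs_of_mul_neg {x y : ℝ} (h : x * y < 0) (hd : 0 < x * (x + y)) :
    |x + y| = |x| - |y| := by
  rcases lt_or_gt_of_ne (show x ≠ 0 by rintro rfl; simp at h) with hx | hx
  · have hy : 0 < y := by nlinarith
    have hxy : x + y < 0 := by nlinarith
    rw [abs_of_neg hx, abs_of_pos hy, abs_of_neg hxy]; ring
  · have hy : y < 0 := by nlinarith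
    have hxy : 0 < x + y := by nlinarith
    rw [abs_of_pos hx, abs_of_neg hy, abs_of_pos hxy]; ring

/-- **CIRCUIT ROW, LOG-LINEAR FORM, TABLE VERSION** (for generated kill files whose numeric side conditions live in a
companion `…Rows` file): as `circuit_row_log_of_sharp`, but the exponent table is passed as a list literal `E` with
`e t = E.getD t 0` on `range n`, so that the three multiplier identities and the two power identities are CLOSED numeral
statements (no reference to the local table `e`) that separate declarations can prove by `norm_num`. [folklore] -/
theorem circuit_row_log_of_table {n : ℕ} {e : ℕ → ℕ} {c : ℕ → ℝ} (he : ∀ i j, i < j → j < n → e i < e j)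
    (hZ : n ≤ (∑ t ∈ range n, C (c t) * X ^ (e t) : ℝ[X]).roots.countP (fun x => 0 < x) + 1)
    (E : List ℕ) (hE : ∀ t, t < n → e t = E.getD t 0)
    {r s u : ℕ} (hrs : r < s) (hsu : s < u) (hun : u < n) (p q : ℕ) (hp : E.getD r 0 + p = E.getD s 0)
    (hq : E.getD s 0 + q = E.getD u 0) (Mr Ms Mu L R : ℝ)
    (hMr : |∏ v ∈ (range n).filter (fun v => ¬(v = r ∨ v = s ∨ v = u)), (((E.getD r 0 : ℕ) : ℝ) - (E.getD v 0 : ℕ))| = Mr)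
    (hMs : |∏ v ∈ (range n).filter (fun v => ¬(v = r ∨ v = s ∨ v = u)), (((E.getD s 0 : ℕ) : ℝ) - (E.getD v 0 : ℕ))| = Ms)
    (hMu : |∏ v ∈ (range n).filter (fun v => ¬(v = r ∨ v = s ∨ v = u)), (((E.getD u 0 : ℕ) : ℝ) - (E.getD v 0 : ℕ))| = Mu)
    (hL : ((p + q : ℕ) : ℝ) ^ (p + q) * (Mr ^ q * Mu ^ p) = L)
    (hR : (q : ℝ) ^ q * (p : ℝ) ^ p * Ms ^ (p + q) = R) :
    Real.log L + q * Real.log |c r| + p * Real.log |c u| ≤ (p + q) * Real.log |c s| + Real.log R := by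
  have hprod : ∀ t, t < n → (∏ v ∈ (range n).filter (fun v => ¬(v = r ∨ v = s ∨ v = u)), ((e t : ℝ) - e v))
      = ∏ v ∈ (range n).filter (fun v => ¬(v = r ∨ v = s ∨ v = u)), (((E.getD t 0 : ℕ) : ℝ) - (E.getD v 0 : ℕ)) := by
    intro t ht
    refine Finset.prod_congr rfl fun v hv => ?_
    have hv' : v < n := mem_range.mp (mem_filter.mp hv).1
    rw [hE t ht, hE v hv']
  exact circuit_row_log_of_sharp he hZ hrs hsu hun p q (by rw [hE r (by omega), hE s (by omega)]; exact hp)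
    (by rw [hE s (by omega), hE u hun]; exact hq) Mr Ms Mu L R (by rw [hprod r (by omega)]; exact hMr)
    (by rw [hprod s (by omega)]; exact hMs) (by rw [hprod u hun]; exact hMu) hL hR

end Summit.ValiantsHypothesis.ValiantsHypothesis.Theorems.LacunarySymmetroidMatrixDescartes.Census
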